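import Mathlib.Analysis.Calculus.Deriv.Inv
import Mathlib.Analysis.Calculus.Deriv.Pow
import Mathlib.Analysis.Calculus.Deriv.Mul
import Mathlib.Analysis.Calculus.Deriv.Add
import Mathlib.Analysis.SpecialFunctions.Pow.Real

/-!
# `BalabanUV.Beta.FP.SliceReciprocalChain` — road «FP» for binder row D1, leaf H2-P, row H2-P-B (generic half, 2∕2): the THIRD-ORDER DERIVATIVE CHAIN OF
# THE RECIPROCAL of a real function along a real parameter — members NAMED, `HasDerivAt` links, letter bounds, and the graded POWER COUNTING
# `κ·r² ≤ |f|`, `|f′| ≤ c₁r`, `|f″| ≤ c₂`, `|f‴| ≤ c₃` ⟹ `|(1∕f)^{(k)}| ≤ C_k∕r^{2+k}` (k ≤ 3) — the `(2ε(s))⁻¹` factor of `B`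

HONEST DEPENDENCY (page 1, mandatory): continuum YM on T⁴ ⇐ BetaPertH ∧ nine spine estimates (0/9 proved); BetaPertH ⇐ (D1) ∧ (D4) ∧ CAP+tail;
G-an2-4 gates asym, D1 and NE2/3/4.  HONEST FRAMING (cell contract, verbatim): «discharging `BetaPertH` makes Bałaban's UV stability UNCONDITIONAL —
a real constructive-QFT result; it is NOT the continuum limit and NOT the Clay problem.»  THIS MODULE DISCHARGES NOTHING of the wall: [folklore] one-variable
calculus (Mathlib `HasDerivAt.inv`∕`.div`∕`.pow`) and arithmetic.  Data defs = NAMES for explicit rational expressions (`rc0…rc3`); no `def … : Prop`; nothing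
cited as a hypothesis; 0 sorry; 0 wall binders; NOT D1, NOT BetaPertH, NOT continuum, NOT Clay.

ABSOLUTE RULE (cell charter, verbatim): «No internally-minted statement may enter as a cited fact. Every hypothesis is either kernel-proved in this package or a
verbatim quotation of a PUBLISHED theorem with page reference. The manuscript(s) under audit are NOT citable for their own disputed steps — they are the thing
under adjudication; programme-internal (2001/route/tribunal) claims are never citable.»

WHAT (`f f₁ f₂ f₃ : ℝ → ℝ`, pointwise at one `t` with `f t ≠ 0`):
* §1 `rc0 := 1∕f`, `rc1 := −f₁∕f²`, `rc2 := (2f₁² − f·f₂)∕f³`, `rc3 := (−6f₁³ + 6f·f₁·f₂ − f²·f₃)∕f⁴`; **`hasDerivAt_rc0∕1∕2`** (`(rc_k)′ = rc_{k+1}` from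
  `HasDerivAt f (f₁ t) t`, `HasDerivAt f₁ (f₂ t) t`, `HasDerivAt f₂ (f₃ t) t`).
* §2 LETTER BOUNDS from `0 < m ≤ |f t|`, `|f₁ t| ≤ a₁`, `|f₂ t| ≤ a₂`, `|f₃ t| ≤ a₃`: `abs_rc0_le` (`≤ 1∕m`), **`abs_rc1_le`** (`≤ a₁∕m²`), **`abs_rc2_le`**
  (`≤ 2a₁²∕m³ + a₂∕m²`), **`abs_rc3_le`** (`≤ 6a₁³∕m⁴ + 6a₁a₂∕m³ + a₃∕m²`).
* §3 POWER COUNTING (`0 < r ≤ R`, `0 < κ`): `κ·r² ≤ |f t|`, `|f₁ t| ≤ c₁·r`, `|f₂ t| ≤ c₂`, `|f₃ t| ≤ c₃` ⟹ **`abs_rc0∕1∕2∕3_le_pc`**: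
  `κ⁻¹∕r²`, `(c₁∕κ²)∕r³`, `(2c₁²∕κ³ + c₂∕κ²)∕r⁴`, `(6c₁³∕κ⁴ + 6c₁c₂∕κ³ + c₃R∕κ²)∕r⁵`.  USE (row H2-P-B): `f(t) = 2ε(i.insertNth t q)
  = (2 − 2cos t) + Σ_{a≠i}(2 − 2cos q_a)`, `f₁ = 2 sin t`, `f₂ = 2cos t`, `f₃ = −2 sin t`, `κ = 4∕π²` (Jordan), `c₁ = 2`, `c₂ = c₃ = 2`, `R = π`.
Provenance: G-an2-4 swarm leaf prover 05, gen 34 (prover-b2b-balaban-gan24-formalise-leaf-05-g34-0), cross-lane on road FP (row H2-P-B claim l.20249), 2026-08-20.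
-/

noncomputable section

namespace Summit.QuantumFields.BalabanUV.Beta.FP.SliceReciprocalChain

open Filter

/-! ## §1–§2 The chain and its letter bounds -/

section RC

variable (f f₁ f₂ f₃ : ℝ → ℝ)

/-- [our object] `rc0 := 1∕f`. -/
def rc0 (s : ℝ) : ℝ := (f s)⁻¹
/-- [our object] `rc1 := −f₁∕f²`. -/
def rc1 (s : ℝ) : ℝ := -f₁ s / f s ^ 2
/-- [our object] `rc2 := (2f₁² − f·f₂)∕f³`. -/
def rc2 (s : ℝ) : ℝ := (2 * f₁ s ^ 2 - f s * f₂ s) / f s ^ 3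
/-- [our object] `rc3 := (−6f₁³ + 6f·f₁·f₂ − f²·f₃)∕f⁴`. -/
def rc3 (s : ℝ) : ℝ := (-6 * f₁ s ^ 3 + 6 * f s * f₁ s * f₂ s - f s ^ 2 * f₃ s) / f s ^ 4

variable {f f₁ f₂ f₃} {t : ℝ} (hf0 : HasDerivAt f (f₁ t) t) (hf1 : HasDerivAt f₁ (f₂ t) t) (hf2 : HasDerivAt f₂ (f₃ t) t) (hft : f t ≠ 0)

include hf0 hft in
/-- [folklore] `(1∕f)′ = rc1`. -/
theorem hasDerivAt_rc0 : HasDerivAt (rc0 f) (rc1 f f₁ t) t := by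
  have h := hf0.fun_inv hft
  have e : rc0 f = fun s => (f s)⁻¹ := rfl
  rw [e]; unfold rc1
  convert h using 1

include hf0 hf1 hft in
/-- [folklore] `(rc1)′ = rc2`. -/
theorem hasDerivAt_rc1 : HasDerivAt (rc1 f f₁) (rc2 f f₁ f₂ t) t := by
  have hden : HasDerivAt (fun s => f s ^ 2) (2 * f t * f₁ t) t := by
    simpa using hf0.fun_pow 2
  have hnum : HasDerivAt (fun s => -f₁ s) (-f₂ t) t := hf1.neg
  have h := hnum.fun_div hden (pow_ne_zero 2 hft)
  have e : rc1 f f₁ = fun s => -f₁ s / f s ^ 2 := rfl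
  rw [e]
  have hval : rc2 f f₁ f₂ t = (-f₂ t * f t ^ 2 - -f₁ t * (2 * f t * f₁ t)) / (f t ^ 2) ^ 2 := by
    unfold rc2; field_simp; ring
  rw [hval]; exact h

include hf0 hf1 hf2 hft in
/-- [folklore] `(rc2)′ = rc3`. -/
theorem hasDerivAt_rc2 : HasDerivAt (rc2 f f₁ f₂) (rc3 f f₁ f₂ f₃ t) t := by
  have hden : HasDerivAt (fun s => f s ^ 3) (3 * f t ^ 2 * f₁ t) t := by
    simpa using hf0.fun_pow 3
  have h1 : HasDerivAt (fun s => f₁ s ^ 2) (2 * f₁ t * f₂ t) t := by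
    simpa using hf1.fun_pow 2
  have hnum : HasDerivAt (fun s => 2 * f₁ s ^ 2 - f s * f₂ s) (2 * (2 * f₁ t * f₂ t) - (f₁ t * f₂ t + f t * f₃ t)) t :=
    (h1.const_mul 2).sub (hf0.mul hf2)
  have h := hnum.fun_div hden (pow_ne_zero 3 hft)
  have e : rc2 f f₁ f₂ = fun s => (2 * f₁ s ^ 2 - f s * f₂ s) / f s ^ 3 := by
    funext s; rfl
  rw [e]
  have hval : rc3 f f₁ f₂ f₃ t
      = ((2 * (2 * f₁ t * f₂ t) - (f₁ t * f₂ t + f t * f₃ t)) * f t ^ 3 - (2 * f₁ t ^ 2 - f t * f₂ t) * (3 * f t ^ 2 * f₁ t)) / (f t ^ 3) ^ 2 := by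
    unfold rc3; field_simp; ring
  rw [hval]; exact h

variable {m a₁ a₂ a₃ : ℝ} (hm : 0 < m) (hmf : m ≤ |f t|) (ha1 : |f₁ t| ≤ a₁) (ha2 : |f₂ t| ≤ a₂) (ha3 : |f₃ t| ≤ a₃)

include hm hmf in
/-- [folklore] `|1∕f| ≤ 1∕m`. -/
theorem abs_rc0_le : |rc0 f t| ≤ 1 / m := by
  unfold rc0; rw [abs_inv, ← one_div]
  exact one_div_le_one_div_of_le hm hmf

include hm hmf ha1 in
/-- [folklore] `|rc1| ≤ a₁∕m²`. -/
theorem abs_rc1_le : |rc1 f f₁ t| ≤ a₁ / m ^ 2 := by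
  unfold rc1
  rw [abs_div, abs_neg, abs_pow]
  have hf2 : m ^ 2 ≤ |f t| ^ 2 := pow_le_pow_left₀ hm.le hmf 2
  have ha0 : 0 ≤ a₁ := (abs_nonneg _).trans ha1
  calc |f₁ t| / |f t| ^ 2 ≤ a₁ / |f t| ^ 2 := div_le_div_of_nonneg_right ha1 (by positivity)
    _ ≤ a₁ / m ^ 2 := div_le_div_of_nonneg_left ha0 (by positivity) hf2

include hm hmf ha1 ha2 in
/-- [folklore] `|rc2| ≤ 2a₁²∕m³ + a₂∕m²`. -/
theorem abs_rc2_le : |rc2 f f₁ f₂ t| ≤ 2 * a₁ ^ 2 / m ^ 3 + a₂ / m ^ 2 := by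
  have hfpos : 0 < |f t| := hm.trans_le hmf
  have hsplit : rc2 f f₁ f₂ t = 2 * f₁ t ^ 2 / f t ^ 3 - f₂ t / f t ^ 2 := by
    unfold rc2; field_simp
  rw [hsplit]
  have ha0 : 0 ≤ a₁ := (abs_nonneg _).trans ha1
  have ha20 : 0 ≤ a₂ := (abs_nonneg _).trans ha2
  have h1 : |2 * f₁ t ^ 2 / f t ^ 3| ≤ 2 * a₁ ^ 2 / m ^ 3 := by
    rw [abs_div, abs_mul, abs_pow, abs_pow, abs_two]
    have hn : 2 * |f₁ t| ^ 2 ≤ 2 * a₁ ^ 2 := by nlinarith [abs_nonneg (f₁ t)]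
    calc 2 * |f₁ t| ^ 2 / |f t| ^ 3 ≤ 2 * a₁ ^ 2 / |f t| ^ 3 := div_le_div_of_nonneg_right hn (by positivity)
      _ ≤ 2 * a₁ ^ 2 / m ^ 3 := div_le_div_of_nonneg_left (by positivity) (by positivity) (pow_le_pow_left₀ hm.le hmf 3)
  have h2 : |f₂ t / f t ^ 2| ≤ a₂ / m ^ 2 := by
    rw [abs_div, abs_pow]
    calc |f₂ t| / |f t| ^ 2 ≤ a₂ / |f t| ^ 2 := div_le_div_of_nonneg_right ha2 (by positivity)
      _ ≤ a₂ / m ^ 2 := div_le_div_of_nonneg_left ha20 (by positivity) (pow_le_pow_left₀ hm.le hmf 2)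
  exact (abs_sub _ _).trans (add_le_add h1 h2)

include hm hmf ha1 ha2 ha3 in
/-- [folklore] `|rc3| ≤ 6a₁³∕m⁴ + 6a₁a₂∕m³ + a₃∕m²`. -/
theorem abs_rc3_le : |rc3 f f₁ f₂ f₃ t| ≤ 6 * a₁ ^ 3 / m ^ 4 + 6 * (a₁ * a₂) / m ^ 3 + a₃ / m ^ 2 := by
  have hfpos : 0 < |f t| := hm.trans_le hmf
  have hsplit : rc3 f f₁ f₂ f₃ t = -(6 * f₁ t ^ 3 / f t ^ 4) + 6 * (f₁ t * f₂ t) / f t ^ 3 - f₃ t / f t ^ 2 := by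
    unfold rc3; field_simp
  rw [hsplit]
  have ha0 : 0 ≤ a₁ := (abs_nonneg _).trans ha1
  have ha20 : 0 ≤ a₂ := (abs_nonneg _).trans ha2
  have ha30 : 0 ≤ a₃ := (abs_nonneg _).trans ha3
  have h1 : |-(6 * f₁ t ^ 3 / f t ^ 4)| ≤ 6 * a₁ ^ 3 / m ^ 4 := by
    rw [abs_neg, abs_div, abs_mul, abs_pow, abs_pow, show |(6:ℝ)| = 6 by norm_num]
    have hn : 6 * |f₁ t| ^ 3 ≤ 6 * a₁ ^ 3 := by
      have := pow_le_pow_left₀ (abs_nonneg _) ha1 3; linarith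
    calc 6 * |f₁ t| ^ 3 / |f t| ^ 4 ≤ 6 * a₁ ^ 3 / |f t| ^ 4 := div_le_div_of_nonneg_right hn (by positivity)
      _ ≤ 6 * a₁ ^ 3 / m ^ 4 := div_le_div_of_nonneg_left (by positivity) (by positivity) (pow_le_pow_left₀ hm.le hmf 4)
  have h2 : |6 * (f₁ t * f₂ t) / f t ^ 3| ≤ 6 * (a₁ * a₂) / m ^ 3 := by
    rw [abs_div, abs_mul, abs_mul, abs_pow, show |(6:ℝ)| = 6 by norm_num]
    have hn : 6 * (|f₁ t| * |f₂ t|) ≤ 6 * (a₁ * a₂) := by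
      have := mul_le_mul ha1 ha2 (abs_nonneg _) ha0; linarith
    calc 6 * (|f₁ t| * |f₂ t|) / |f t| ^ 3 ≤ 6 * (a₁ * a₂) / |f t| ^ 3 := div_le_div_of_nonneg_right hn (by positivity)
      _ ≤ 6 * (a₁ * a₂) / m ^ 3 := div_le_div_of_nonneg_left (by positivity) (by positivity) (pow_le_pow_left₀ hm.le hmf 3)
  have h3 : |f₃ t / f t ^ 2| ≤ a₃ / m ^ 2 := by
    rw [abs_div, abs_pow]
    calc |f₃ t| / |f t| ^ 2 ≤ a₃ / |f t| ^ 2 := div_le_div_of_nonneg_right ha3 (by positivity)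
      _ ≤ a₃ / m ^ 2 := div_le_div_of_nonneg_left ha30 (by positivity) (pow_le_pow_left₀ hm.le hmf 2)
  calc |-(6 * f₁ t ^ 3 / f t ^ 4) + 6 * (f₁ t * f₂ t) / f t ^ 3 - f₃ t / f t ^ 2|
      ≤ |-(6 * f₁ t ^ 3 / f t ^ 4) + 6 * (f₁ t * f₂ t) / f t ^ 3| + |f₃ t / f t ^ 2| := abs_sub _ _
    _ ≤ (|-(6 * f₁ t ^ 3 / f t ^ 4)| + |6 * (f₁ t * f₂ t) / f t ^ 3|) + |f₃ t / f t ^ 2| := by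
        gcongr; exact abs_add_le _ _
    _ ≤ _ := by linarith [h1, h2, h3]

end RC


/-! ## §3 Power counting -/

section PC

variable {t r : ℝ} (hr : 0 < r)
variable {f f₁ f₂ f₃ : ℝ → ℝ} {κ c₁ c₂ c₃ R : ℝ} (hκ : 0 < κ) (hrR : r ≤ R)
  (pf : κ * r ^ 2 ≤ |f t|) (pf1 : |f₁ t| ≤ c₁ * r) (pf2 : |f₂ t| ≤ c₂) (pf3 : |f₃ t| ≤ c₃)

include hr hκ pf in
/-- [our object] GRADED RECIPROCAL, order 0 (letters `κ·r² ≤ |f|`, `|f₁| ≤ c₁·r`, `|f₂| ≤ c₂`, `|f₃| ≤ c₃`): `|1∕f| ≤ κ⁻¹∕r²`. -/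
theorem abs_rc0_le_pc : |rc0 f t| ≤ κ⁻¹ / r ^ 2 := by
  have hm : 0 < κ * r ^ 2 := by positivity
  have h := abs_rc0_le hm pf
  have hr0 : r ≠ 0 := hr.ne'
  calc |rc0 f t| ≤ 1 / (κ * r ^ 2) := h
    _ = κ⁻¹ / r ^ 2 := by field_simp

include hr hκ pf pf1 in
/-- [our object] … order 1: `|rc1| ≤ (c₁∕κ²)∕r³`. -/
theorem abs_rc1_le_pc : |rc1 f f₁ t| ≤ (c₁ / κ ^ 2) / r ^ 3 := by
  have hm : 0 < κ * r ^ 2 := by positivity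
  have h := abs_rc1_le hm pf pf1
  have hr0 : r ≠ 0 := hr.ne'
  calc |rc1 f f₁ t| ≤ c₁ * r / (κ * r ^ 2) ^ 2 := h
    _ = (c₁ / κ ^ 2) / r ^ 3 := by field_simp

include hr hκ pf pf1 pf2 in
/-- [our object] … order 2: `|rc2| ≤ (2c₁²∕κ³ + c₂∕κ²)∕r⁴`. -/
theorem abs_rc2_le_pc : |rc2 f f₁ f₂ t| ≤ (2 * c₁ ^ 2 / κ ^ 3 + c₂ / κ ^ 2) / r ^ 4 := by
  have hm : 0 < κ * r ^ 2 := by positivity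
  have h := abs_rc2_le hm pf pf1 pf2
  have hr0 : r ≠ 0 := hr.ne'
  calc |rc2 f f₁ f₂ t| ≤ 2 * (c₁ * r) ^ 2 / (κ * r ^ 2) ^ 3 + c₂ / (κ * r ^ 2) ^ 2 := h
    _ = (2 * c₁ ^ 2 / κ ^ 3 + c₂ / κ ^ 2) / r ^ 4 := by field_simp

include hr hκ hrR pf pf1 pf2 pf3 in
/-- [our object] … order 3 (`0 < r ≤ R`; the `c₃∕(κ²r⁴)` term is majorised by `c₃R∕(κ²r⁵)`): `|rc3| ≤ (6c₁³∕κ⁴ + 6c₁c₂∕κ³ + c₃R∕κ²)∕r⁵`. -/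
theorem abs_rc3_le_pc : |rc3 f f₁ f₂ f₃ t| ≤ (6 * c₁ ^ 3 / κ ^ 4 + 6 * (c₁ * c₂) / κ ^ 3 + c₃ * R / κ ^ 2) / r ^ 5 := by
  have hm : 0 < κ * r ^ 2 := by positivity
  have h := abs_rc3_le hm pf pf1 pf2 pf3
  have hr0 : r ≠ 0 := hr.ne'
  have hc3 : 0 ≤ c₃ := (abs_nonneg _).trans pf3
  have hlast : c₃ / (κ * r ^ 2) ^ 2 ≤ c₃ * R / κ ^ 2 / r ^ 5 := by
    have e : c₃ / (κ * r ^ 2) ^ 2 = c₃ * r / κ ^ 2 / r ^ 5 := by field_simp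
    rw [e]
    exact div_le_div_of_nonneg_right (div_le_div_of_nonneg_right (mul_le_mul_of_nonneg_left hrR hc3) (by positivity))
      (by positivity)
  have e1 : 6 * (c₁ * r) ^ 3 / (κ * r ^ 2) ^ 4 = 6 * c₁ ^ 3 / κ ^ 4 / r ^ 5 := by field_simp
  have e2 : 6 * (c₁ * r * c₂) / (κ * r ^ 2) ^ 3 = 6 * (c₁ * c₂) / κ ^ 3 / r ^ 5 := by field_simp
  calc |rc3 f f₁ f₂ f₃ t| ≤ 6 * (c₁ * r) ^ 3 / (κ * r ^ 2) ^ 4 + 6 * (c₁ * r * c₂) / (κ * r ^ 2) ^ 3 + c₃ / (κ * r ^ 2) ^ 2 := h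
    _ ≤ 6 * c₁ ^ 3 / κ ^ 4 / r ^ 5 + 6 * (c₁ * c₂) / κ ^ 3 / r ^ 5 + c₃ * R / κ ^ 2 / r ^ 5 := by rw [e1, e2]; linarith [hlast]
    _ = (6 * c₁ ^ 3 / κ ^ 4 + 6 * (c₁ * c₂) / κ ^ 3 + c₃ * R / κ ^ 2) / r ^ 5 := by ring

end PC

end Summit.QuantumFields.BalabanUV.Beta.FP.SliceReciprocalChain

end
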